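import Literature.Probability.Process.PointStationaryLaw
import Literature.MathematicalPhysics.StatisticalMechanics.MuGSC
import Mathlib.Analysis.Normed.Lp.MeasurableSpace
import HarnessLib

/-!
# Route `ReggeStarCoercivity`, crux `DefectFreeCrystallizes` (stmt-AtomisticToContinuum-13603), line `palm-good-law`
# (skeleton v27, stub A `stub_annulusCount`): ATOMS IN THE ANNULUS `11/10 < ‖y‖ ≤ 5/4` OF A HARD-CORE CONFIGURATION

**Theorem** (`stub_annulusCount`).  For every `δ > 0` there is a natural number `N = N(δ)` such that every
rooted `δ`-hard-core configuration `μ = count|S` (`S ∋ 0` a `δ`-separated subset of `ℝ³`,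
`Literature.Probability.Process.IsRootedHardCore`) gives the annulus `{y : 11/10 < ‖y‖ ≤ 5/4}` mass at most `N`.

**Proof** (packing).  `μ(annulus) = count (annulus ∩ S)` (`Measure.restrict_apply`; the annulus is
measurable), `annulus ∩ S` is a `δ`-separated subset of the closed ball of radius `5/4` about `0`, hence finite
(`UniformlyDiscrete.finite_inter_closedBall`) with at most `(2·(5/4)/δ + 1)³` points
(`card_le_of_separated_of_dist_le`, the volume argument), and `Measure.count_apply_finite` turns the count into
a cardinality; `N = ⌈(2·(5/4)/δ + 1)³⌉₊`.  All `[folklore]`.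

Imports: only modules already imported by the line's skeleton (`PointStationaryLaw`, `MuGSC`) and Mathlib, so
that the skeleton can import this file (`MuGSC` and `MuGroundStateConfiguration` both declare
`UniformlyDiscrete` and cannot be imported together).
-/

noncomputable section

namespace Summit.AtomisticToContinuum.Crystallization.Theorems.PalmGoodLaw.AnnulusCount

open scoped ENNReal
open MeasureTheory Set Metric
open Literature.Probability.Process
open Literature.MathematicalPhysics.StatisticalMechanics

/-- **Packing count of a separated set in the annulus.**  A `δ`-separated (`δ > 0`) subset `S ⊆ ℝ³` meets the
annulus `11/10 < ‖y‖ ≤ 5/4` in a finite set of at most `(2·(5/4)/δ + 1)³` points (it lies in the closed ball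
of radius `5/4` about the origin; volume argument `card_le_of_separated_of_dist_le`). [folklore] -/
theorem finite_and_ncard_annulus_le {δ : ℝ} (hδ : 0 < δ) {S : Set (EuclideanSpace ℝ (Fin 3))}
    (hsep : ∀ x ∈ S, ∀ y ∈ S, x ≠ y → δ ≤ dist x y) :
    ({y : EuclideanSpace ℝ (Fin 3) | 11 / 10 < ‖y‖ ∧ ‖y‖ ≤ 5 / 4} ∩ S).Finite ∧
      ((({y : EuclideanSpace ℝ (Fin 3) | 11 / 10 < ‖y‖ ∧ ‖y‖ ≤ 5 / 4} ∩ S).ncard : ℝ) ≤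
        (2 * (5 / 4) / δ + 1) ^ 3) := by
  set A : Set (EuclideanSpace ℝ (Fin 3)) := {y | 11 / 10 < ‖y‖ ∧ ‖y‖ ≤ 5 / 4} with hA
  have hsub : A ∩ S ⊆ S ∩ closedBall (0 : EuclideanSpace ℝ (Fin 3)) (5 / 4) := by
    intro y hy
    refine ⟨hy.2, ?_⟩
    rw [mem_closedBall, dist_zero_right]
    exact hy.1.2
  have hfin : (A ∩ S).Finite :=
    (UniformlyDiscrete.finite_inter_closedBall ⟨δ, hδ, hsep⟩ (0 : EuclideanSpace ℝ (Fin 3)) (5 / 4)).subset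
      hsub
  refine ⟨hfin, ?_⟩
  rw [Set.ncard_eq_toFinset_card _ hfin]
  have h := card_le_of_separated_of_dist_le hfin.toFinset (0 : EuclideanSpace ℝ (Fin 3)) hδ
    (by norm_num : (0 : ℝ) ≤ 5 / 4)
    (fun p hp => by
      rw [dist_zero_right]
      exact ((Set.Finite.mem_toFinset hfin).1 hp).1.2)
    (fun p hp q hq hpq => hsep p ((Set.Finite.mem_toFinset hfin).1 hp).2 q
      ((Set.Finite.mem_toFinset hfin).1 hq).2 hpq)
  rwa [finrank_euclideanSpace_fin] at h

/-- **A `stub_annulusCount` (line `palm-good-law`, skeleton v27; packing).**  For every `δ > 0` there is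
`N : ℕ` such that on every rooted `δ`-hard-core configuration `μ = count|S` the number of atoms in the annulus
`11/10 < ‖y‖ ≤ 5/4` is at most `N` (here `N = ⌈(2·(5/4)/δ + 1)³⌉₊`, by `finite_and_ncard_annulus_le`). [folklore] -/
theorem stub_annulusCount :
    ∀ δ : ℝ, 0 < δ → ∃ N : ℕ,
      ∀ μ : Measure (EuclideanSpace ℝ (Fin 3)), IsRootedHardCore δ μ →
        μ {y : EuclideanSpace ℝ (Fin 3) | 11 / 10 < ‖y‖ ∧ ‖y‖ ≤ 5 / 4} ≤ N := by
  intro δ hδ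
  refine ⟨⌈(2 * (5 / 4 : ℝ) / δ + 1) ^ 3⌉₊, ?_⟩
  rintro μ ⟨S, -, hsep, rfl⟩
  have hAm : MeasurableSet {y : EuclideanSpace ℝ (Fin 3) | 11 / 10 < ‖y‖ ∧ ‖y‖ ≤ 5 / 4} :=
    (measurableSet_lt measurable_const measurable_norm).inter
      (measurableSet_le measurable_norm measurable_const)
  obtain ⟨hfin, hcard⟩ := finite_and_ncard_annulus_le hδ hsep
  rw [Measure.restrict_apply hAm, Measure.count_apply_finite _ hfin]
  rw [Set.ncard_eq_toFinset_card _ hfin] at hcard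
  have hnat : hfin.toFinset.card ≤ ⌈(2 * (5 / 4 : ℝ) / δ + 1) ^ 3⌉₊ :=
    Nat.cast_le.1 (hcard.trans (Nat.le_ceil _))
  exact_mod_cast hnat

end Summit.AtomisticToContinuum.Crystallization.Theorems.PalmGoodLaw.AnnulusCount

end
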